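import Literature.MathematicalPhysics.QuantumFieldTheory.Balaban1983to89.B9Eq326G1kSupRowClosed
import Literature.MathematicalPhysics.QuantumFieldTheory.Balaban1983to89.Beta.RemainderHasMajGreenPrime

/-!
# T. Bałaban, *Propagators for lattice gauge theories in a background field*, Commun. Math. Phys. **99** (1985) 389–434
# [Balaban1985BackgroundPropagators] Thm 3.3 (3.42) p. 397 + p. 399 with [Balaban1985Variational] p. 297 after (128), (190) p. 308 and [Balaban1984PropagatorsII]
# (2.51)–(2.52) p. 232: **THE `hG0` LETTER OF ROW (D4)'s NODE D ON NE9's TOWER — the height-free sup row of the bond Green's function `G₁,k(U) = Δ_{a,k}(U)⁻¹`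
# (the NE9 crew's END `B9Eq326G1kSupRowClosed.exists_local_letter_G1k`) AS `HasMaj S^{fine}_m S^{fine}_m ((e ∘ G₁,k ∘ e⁻¹)↾ℝ) (B·e^{−δ·d_∞})` BETWEEN THE SUP
# SIZES OF (190), `∃ (α₁, B, δ)` BEFORE THE HEIGHT, THE PERIOD AND THE BACKGROUND**

CITATION HEADER (lean-in-tree rule 2026-08-18).  Sources: [Balaban1985BackgroundPropagators] (B9 = [5] of [15]; held `paper:balaban1985-cmp99-background-propagators`,
journal page = PDF page + 388): Thm 3.1 (3.42) p. 397 (first entry: the sup bound `|(G′(U)λ)(x)| ≤ B₀e^{−δ₀d(y,y′)}|λ|` for `x ∈ Δ(y)`, `supp λ ⊂ Δ(y′)` —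
the display's shape; its OCR in the held text layer is degraded), Thm 3.3 p. 399 (*«the operator G(U) (a = 1) satisfies the inequalities (3.42)–(3.47), with
G′(U) replaced by G(U) and λ replaced by a function J defined at bonds»*), (3.26) p. 395, Thm 3.11 p. 416; [Balaban1985Variational]
(B11 = [15]; `paper:balaban1985-cmp102-variational-background`, journal page = PDF page + 276): p. 297 after (128) (*«Δ_a = Δ + DRD* + Q*aQ … For the operator
Δ_a⁻¹ = G we have proved Theorem 3.3 in [5], and especially the bounds (3.42)»*), (182) p. 307, (190) p. 308; [Balaban1984PropagatorsII] (B6) (2.51)–(2.52)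
p. 232.  [15] p. 297 and [5] pp. 397–399 as quoted in the headers of the tree files consumed ((K64) of ne9-leaf-05 g87, `Beta.RemainderHasMajGreenPrime`);
[15] pp. 297, 306–308 re-read this generation in the held text layer.

WHY THIS FILE (audit cell `pub-balaban`, BINDER row (D4), OWNER lineage `b2b-balaban-beta-an4`, gen 111; the junction «Y4d» announced in HANDOFF § [AN4-G110]
(2)(a) and journal [AN4-G111-INTENT-1]).  V79 `Beta.RemainderOriginTwoLetters.ineq190_origin_of_two_letters` (NODE D at the origin in a background) and its
tower instance `Beta.RemainderOriginTower.exists_ineq190_origin_tower_sup` («Y5b») consume ONE analytic letter, `hG0 : HasMaj S^{fine}_m S^{fine}_m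
((e∘G₁,k∘e⁻¹)↾ℝ) (B₀·e^{−δ₀·d_∞})` — [5] Thm 3.3 (3.42), first entry, for the BOND operator `Δ_a⁻¹` of [15] (129), in the (190) sup currency (the (D4) socket is
sup → sup: [I] (4.4) is a sup-norm ball).  This lineage's INTERFACE REQUEST D4 (journal l.64394) asked the NE9 cell for exactly the pointwise row
`‖(G₁,k f)(b)‖ ≤ B·e^{−δ·d_m(Π(b₋), v)}·F` for `f` supported over the big block `Π⁻¹(v)` with `‖f‖_∞ ≤ F`, `∃ (α₁, B, δ)` BEFORE the height; the NE9 crew's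
END `B9Eq326G1kSupRowClosed.exists_local_letter_G1k` (ne9-leaf-05 g87; Woodbury around the tower local part `A₀,k = Δ(U) + D_UD_U* + aQ*Q` — (ECL) Kato
bootstrap, storey J = the OWNER t4-ne9-p1's covariant-gradient row (GRC), Combes–Thomas (FCLG), (WST), the (L)-algebra (K61)∕(K62)) PROVES it on the cell's
MODEL letters.  THIS FILE is the junction, token for token: `Beta.RemainderHasMajGreenPrime.hasMaj_supSize_of_local` at `X := Bond d (towerP L m (n+1))`,
`blk := UT.ofSite ∘ blockCoord (L^(n+1)) m ∘ siteCast ∘ bpos` (boxes = its fibres) turns the pointwise row into the block majorant.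
* **`exists_hasMaj_G1k_tower_sup`** — `∃ α₁ B δ, 0 < α₁ ∧ 0 ≤ B ∧ 0 < δ ∧ ∀ ⟨(K64)'s block: n η (ηL^{n+1} = 1) c₀ c₁ (c₀(L^{n+1})^d = c₁) (|η|^d∕c₀ ≤ ρ_w) m
  (1 ≤ m_i) U αU hα0 hα1 hU1 hreg εU hεU hUε hLb α (0 ≤ α ≤ α₁) hUst hUb hUη hpl hUgrad hRlev hεg hAQ hpos′ hpos⟩ (η₀ L₀ M₀ R) (H),
  HasMaj S^{fine}_m S^{fine}_m ((e ∘ G1k L m n φ η U hL αU hα1 hU1 hreg τ hpos ∘ e⁻¹)↾ℝ) (fun y v ↦ B·e^{−δ·tdist m (toSite y) (toSite v)})` — EXACTLY the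
  `hG0` binder of «Y5b» `exists_ineq190_origin_tower_sup` ∕ «Y5a» `hasMaj_H1_tower_sup`, for every height, period, background in the window, and geometry.
AFTER THIS FILE every letter of V79 on NE9's tower is a tree theorem BY NAME on the cell's MODEL except `hD2` ((3.137): NODE O) and the numerics; the remaining
work for NODE D at the origin on `Ω_k = T_η` is the ∃-first END over the tower (compose «Y4a» ∕ this file ∕ «Y5b») and the carrier plumbing into `Data190`.

HONEST SCOPE.  [folklore] ONE application of the socket lemma to the NE9 END, nothing restated; NO estimate of [5] is proved here; the constants `(α₁, B, δ)` are
the NE9 crew's (crude, height-free), NOT print's `B₀, δ₀`; the statement is about the cell's MODEL (a background small on every bond with the bond-gradient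
datum `hUgrad`, contractive level transporters `hRlev`, level averages in the window, the summable regime `Σ_{j<n+1} α_j ≤ A_Q`, positivity of `Δ_{a,k}` ∕
`Δ′_{a′,k}` DISPLAYED as `hpos` ∕ `hpos′`) — «NE9 ⇐ the named binders» travels with it; nothing identifies Bałaban's step-`k` objects with tree terms beyond NE9's
`Ω_k = T_η` tower (NODE O FROZEN (0)).  Row (D4) class UNCHANGED (instance 0∕1; D4 DISCHARGE NO DATE); NOT B12 Thm 2, NOT BetaPertH, NOT continuum, NOT Clay.
HONEST DEPENDENCY (cell line): continuum YM on T⁴ ⇐ BetaPertH ∧ nine spine estimates (0/9 proved); BetaPertH ⇐ (D1) ∧ (D4) ∧ CAP+tail; G-an2-4 gates asym, D1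
and NE2/3/4.  NEW file importing (K64) `B9Eq326G1kSupRowClosed` and `Beta.RemainderHasMajGreenPrime`; nothing modified; 0 `def`; standard axioms; no `sorry`.
Net new unproved facts: 0.
-/

noncomputable section

open scoped BigOperators InnerProductSpace ComplexConjugate

namespace Literature.MathematicalPhysics.QuantumFieldTheory.Balaban1983to89.Beta.RemainderHasMajG1kTower

open B11SectG B11SupSize190
open B4Sect5Torus (TSite tdist tdist_nonneg)
open B5TorusCover (UT)
open B9Thm34Ext (toB6)
open B9Thm37GlueTorus (torusGeom)
open B9SectCLatticeCarrier (Bond bpos unshift)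
open B9Eq311L2Pairing (WL2)
open B9Eq319QprimeTorus (blockCoord)
open B9Eq315QTower (towerP UlevOf)
open B9Eq315QTorus (perCfg cornerSite)
open B9Eq316TowerFlatIsOneStep (siteCast towerP_eq_fineP_pow)
open B7Prop1Explicit (U1 Wcx boxVec)
open B9Eq310DeltaPrime (plaqHolU)
open B9Eq310HessianOperator (adTransportW)
open B11Eq103H1Complex (SiteL2K BondL2K)
open B9Eq326OperatorTower (laplaceAk G1k)
open B9Eq324DeltaPrimeATower (laplacePrimeAk)
open B9Eq326G1kSupRowClosed (exists_local_letter_G1k)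
open Beta.RemainderHasMajGreenPrime (hasMaj_supSize_of_local)

/-! ### Torus bookkeeping (private) -/

section Aux

variable {d : ℕ} {m : Fin d → ℕ}

/-- `ofSite a = y ↔ a = toSite y`. [folklore] -/
private theorem ofSite_eq_iff (a : TSite d m) (y : UT m) : UT.ofSite m a = y ↔ a = UT.toSite m y := by
  constructor
  · rintro rfl; rfl
  · rintro rfl; rfl

/-- The boxes of the fine-bond big-block map are its fibres. [folklore] -/
private theorem mem_boxFine_iff {L : ℕ} [NeZero L] {n : ℕ} (y : UT m) (b : Bond d (towerP L m (n + 1))) :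
    b ∈ (Finset.univ.filter fun b : Bond d (towerP L m (n + 1)) =>
        blockCoord (L ^ (n + 1)) m (siteCast (towerP_eq_fineP_pow L m (n + 1)) (bpos b)) = UT.toSite m y) ↔
      UT.ofSite m (blockCoord (L ^ (n + 1)) m (siteCast (towerP_eq_fineP_pow L m (n + 1)) (bpos b))) = y := by
  rw [Finset.mem_filter, ofSite_eq_iff]
  simp

end Aux

/-! ## The `hG0` letter on NE9's tower: (K64) in the (190) sup currency, `∃ (α₁, B, δ)` first -/

section Tower

variable {d : ℕ} (hd : 1 ≤ d) (L : ℕ) [NeZero L] (hL : 1 ≤ L) (hL3 : 3 ≤ L)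
  {𝔸 : Type*} [NormedRing 𝔸] [NormedAlgebra ℂ 𝔸] [CompleteSpace 𝔸] [NormOneClass 𝔸] [StarRing 𝔸] [NormedStarGroup 𝔸] [StarModule ℂ 𝔸]
  {W : Type} [NormedAddCommGroup W] [InnerProductSpace ℂ W] [FiniteDimensional ℂ W] (φ : W ≃ₗ[ℂ] 𝔸)
  {Mφ Mφ' : ℝ} (hMφ : 0 ≤ Mφ) (hMφ' : 0 ≤ Mφ') (hφ : ∀ w, ‖φ w‖ ≤ Mφ * ‖w‖) (hφ' : ∀ X, ‖φ.symm X‖ ≤ Mφ' * ‖X‖) (hstar : ∀ X : 𝔸, ‖star X‖ ≤ ‖X‖)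
  {a : ℝ} (ha : 0 < a) {a' : ℝ} (ha' : 0 < a') {ϱ : ℝ} (hϱ0 : 0 ≤ ϱ) (hϱ1 : ϱ < 1)
  (τ : 𝔸 →ₗ[ℂ] ℂ) {Cτ : ℝ} (hτ : ∀ X, ‖τ X‖ ≤ Cτ * ‖X‖) (hCτ : 0 ≤ Cτ) {Mτ : ℝ} (hτm : ∀ X Y : 𝔸, ‖τ (X * Y)‖ ≤ Mτ * ‖X‖ * ‖Y‖) (hMτ : 0 ≤ Mτ)
  {ρw : ℝ} (hρw : 0 ≤ ρw)
  (hτ₁ : ∀ X : 𝔸, τ (star X) = conj (τ X)) (hτ₂ : ∀ X Y : 𝔸, τ (X * Y) = τ (Y * X)) (hφτ : ∀ X Y : 𝔸, ⟪φ.symm X, φ.symm Y⟫_ℂ = τ (star X * Y))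
  (AQ : ℝ)

include hd hL hL3 hMφ hMφ' hφ hφ' hstar ha ha' hϱ0 hϱ1 hτ hCτ hτm hMτ hρw hτ₁ hτ₂ hφτ in
/-- **THE `hG0` LETTER OF NODE D ON NE9's TOWER — (K64) `exists_local_letter_G1k` AS `HasMaj S^{fine}_m S^{fine}_m ((e ∘ G₁,k ∘ e⁻¹)↾ℝ) (B·e^{−δ·d_∞})`,
`∃ (α₁, B, δ)` BEFORE THE HEIGHT** ([5] Thm 3.3: (3.42) first entry for the bond Green's function `G(U) = Δ_a(U)⁻¹`; [15] p. 297).  Binders = (K64)'s,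
token for token, minus its source datum `(v, f, F)` (quantified inside the majorant), plus an arbitrary torus geometry `(η₀, L₀, M₀, R, H)`; the sup sizes of
(190) over the torus of blocks `T_m` with the fine bonds blocked by `blockCoord (L^(n+1)) m ∘ siteCast ∘ bpos` (boxes = its fibres).  One application of
`Beta.RemainderHasMajGreenPrime.hasMaj_supSize_of_local`; the operator `G1k L m n φ η U hL αU hα1 hU1 hreg τ hpos` and the constants `(α₁, B, δ)` are the NE9
crew's, untouched. [cite: Balaban1985BackgroundPropagators, Thm 3.1 (3.42) p.397, Thm 3.3 p.399, (3.26) p.395, Thm 3.11 p.416]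
[cite: Balaban1985Variational, p.297 after (128), (190) p.308] [cite: Balaban1984PropagatorsII, (2.51)–(2.52) p.232] -/
theorem exists_hasMaj_G1k_tower_sup :
    ∃ α₁ B δ : ℝ, 0 < α₁ ∧ 0 ≤ B ∧ 0 < δ ∧
      ∀ (n : ℕ) (η : ℝ) (_hηL : η * (L : ℝ) ^ (n + 1) = 1) (c₀ c₁ : ℝ) [Fact (0 < c₀)] [Fact (0 < c₁)]
        (_hw : c₀ * ((L : ℝ) ^ (n + 1)) ^ d = c₁) (_hρ : |η| ^ d / c₀ ≤ ρw) (m : Fin d → ℕ) [∀ i, NeZero (m i)] (_hm : ∀ i, 1 ≤ m i)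
        (U : Bond d (towerP L m (n + 1)) → 𝔸ˣ) (αU : ℕ → ℝ) (_hα0 : ∀ j, 0 ≤ αU j) (hα1 : ∀ j, αU j ≤ 1 / 64)
        (hU1 : ∀ (j : ℕ) (x : B7Prop1Explicit.Site d) (k : Fin d), perCfg (towerP L m (j + 1)) (UlevOf L m (n + 1) U j) x k ∈ U1 𝔸)
        (hreg : ∀ (j : ℕ) (y : TSite d (towerP L m j)) (k : Fin d) (ρ' : Fin d → Fin L),
          ‖((Wcx L (perCfg (towerP L m (j + 1)) (UlevOf L m (n + 1) U j)) (cornerSite L y) k (boxVec L ρ') : 𝔸ˣ) : 𝔸) - 1‖ ≤ αU j)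
        (εU : ℕ → ℝ) (_hεU : ∀ j, 0 ≤ εU j) (_hUε : ∀ (j : ℕ) (b : Bond d (towerP L m (j + 1))), ‖(UlevOf L m (n + 1) U j b : 𝔸) - 1‖ ≤ εU j)
        (_hLb : ∀ (j : ℕ) (b : Bond d (towerP L m (j + 1))), UlevOf L m (n + 1) U j b ∈ U1 𝔸)
        (α : ℝ) (_hα : 0 ≤ α) (_hαle : α ≤ α₁)
        (hUst : ∀ b, star (U b : 𝔸) = (((U b)⁻¹ : 𝔸ˣ) : 𝔸)) (_hUb : ∀ b, U b ∈ U1 𝔸) (_hUη : ∀ b, ‖(U b : 𝔸) - 1‖ ≤ α * η)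
        (_hpl : ∀ p : B9SectCLatticeCarrier.Plaq d (towerP L m (n + 1)), ‖(plaqHolU U p : 𝔸) - 1‖ ≤ α * η ^ 2)
        (_hUgrad : ∀ (x : TSite d (towerP L m (n + 1))) (μ : Fin d), ‖(U (x, μ) : 𝔸) - U (unshift μ x, μ)‖ ≤ α * η ^ 2)
        (_hRlev : ∀ (j : ℕ) (b : Bond d (towerP L m (j + 1))) (w : W), ‖adTransportW φ (UlevOf L m (n + 1) U j) b w‖ ≤ ‖w‖)
        (_hεg : ∀ j < n + 1, εU j ≤ α * ϱ ^ j) (_hAQ : ∑ j ∈ Finset.range (n + 1), αU j ≤ AQ)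
        (hpos' : ∀ x : SiteL2K ℂ d (towerP L m (n + 1)) c₀ W, x ≠ 0 → 0 < RCLike.re ⟪x, laplacePrimeAk L m n φ η U a' (c₁ := c₁) x⟫_ℂ)
        (hpos : ∀ x : BondL2K ℂ d (towerP L m (n + 1)) c₀ W, x ≠ 0 →
          0 < RCLike.re ⟪x, laplaceAk L m n φ η U hL αU hα1 hU1 hreg τ (c₀ := c₀) (c₁ := c₁) a x⟫_ℂ)
        (η₀ L₀ M₀ R : ℝ) (H : Prop),
        HasMaj
          (supSize (toB6 (torusGeom m η₀ L₀ M₀) R H)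
            (fun y => Finset.univ.filter fun b : Bond d (towerP L m (n + 1)) =>
              blockCoord (L ^ (n + 1)) m (siteCast (towerP_eq_fineP_pow L m (n + 1)) (bpos b)) = UT.toSite m y)
            (fun b => UT.ofSite m (blockCoord (L ^ (n + 1)) m (siteCast (towerP_eq_fineP_pow L m (n + 1)) (bpos b)))) :
              BlockNorm (toB6 (torusGeom m η₀ L₀ M₀) R H) (Bond d (towerP L m (n + 1)) → W))
          (supSize (toB6 (torusGeom m η₀ L₀ M₀) R H)
            (fun y => Finset.univ.filter fun b : Bond d (towerP L m (n + 1)) =>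
              blockCoord (L ^ (n + 1)) m (siteCast (towerP_eq_fineP_pow L m (n + 1)) (bpos b)) = UT.toSite m y)
            (fun b => UT.ofSite m (blockCoord (L ^ (n + 1)) m (siteCast (towerP_eq_fineP_pow L m (n + 1)) (bpos b)))))
          (((WL2.linearEquiv ℂ ℂ (fun _ : Bond d (towerP L m (n + 1)) => c₀) :
                BondL2K ℂ d (towerP L m (n + 1)) c₀ W ≃ₗ[ℂ] (Bond d (towerP L m (n + 1)) → W)).toLinearMap ∘ₗ
              G1k L m n φ η U hL αU hα1 hU1 hreg τ (c₀ := c₀) (c₁ := c₁) hpos ∘ₗ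
              (WL2.linearEquiv ℂ ℂ (fun _ : Bond d (towerP L m (n + 1)) => c₀) :
                BondL2K ℂ d (towerP L m (n + 1)) c₀ W ≃ₗ[ℂ] (Bond d (towerP L m (n + 1)) → W)).symm.toLinearMap).restrictScalars ℝ)
          (fun y v => B * Real.exp (-(δ * tdist m (UT.toSite m y) (UT.toSite m v)))) := by
  obtain ⟨α₁, B, δ, hα₁, hB, hδ, HK⟩ := exists_local_letter_G1k hd L hL hL3 φ hMφ hMφ' hφ hφ' hstar ha ha' hϱ0 hϱ1 τ hτ hCτ hτm hMτ hρw hτ₁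
    hτ₂ hφτ AQ
  refine ⟨α₁, B, δ, hα₁, hB, hδ, ?_⟩
  intro n η hηL c₀ c₁ _ _ hw hρ m _ hm U αU hα0 hα1 hU1 hreg εU hεU hUε hLb α hα hαle hUst hUb hUη hpl hUgrad hRlev hεg hAQ hpos' hpos η₀ L₀ M₀ R H
  refine hasMaj_supSize_of_local (fun y b => mem_boxFine_iff y b) _ (fun y v => by positivity) ?_
  intro v f F hfv hfF b
  -- the carrier element `e⁻¹ f`, whose values are those of `f`
  set f' : BondL2K ℂ d (towerP L m (n + 1)) c₀ W :=
    (WL2.linearEquiv ℂ ℂ (fun _ : Bond d (towerP L m (n + 1)) => c₀) :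
      BondL2K ℂ d (towerP L m (n + 1)) c₀ W ≃ₗ[ℂ] (Bond d (towerP L m (n + 1)) → W)).symm f with hf'
  have hfv' : ∀ b, blockCoord (L ^ (n + 1)) m (siteCast (towerP_eq_fineP_pow L m (n + 1)) (bpos b)) ≠ UT.toSite m v →
      WL2.equiv ℂ (fun _ : Bond d (towerP L m (n + 1)) => c₀) W f' b = 0 := by
    intro b hb
    have hne : UT.ofSite m (blockCoord (L ^ (n + 1)) m (siteCast (towerP_eq_fineP_pow L m (n + 1)) (bpos b))) ≠ v :=
      fun h => hb ((ofSite_eq_iff _ _).1 h)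
    exact hfv b hne
  have hfF' : ∀ b, ‖WL2.equiv ℂ (fun _ : Bond d (towerP L m (n + 1)) => c₀) W f' b‖ ≤ F := fun b => hfF b
  -- the value of the conjugated operator is that of `G₁,k f′`
  have hval : (((WL2.linearEquiv ℂ ℂ (fun _ : Bond d (towerP L m (n + 1)) => c₀) :
            BondL2K ℂ d (towerP L m (n + 1)) c₀ W ≃ₗ[ℂ] (Bond d (towerP L m (n + 1)) → W)).toLinearMap ∘ₗ
          G1k L m n φ η U hL αU hα1 hU1 hreg τ (c₀ := c₀) (c₁ := c₁) hpos ∘ₗ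
          (WL2.linearEquiv ℂ ℂ (fun _ : Bond d (towerP L m (n + 1)) => c₀) :
            BondL2K ℂ d (towerP L m (n + 1)) c₀ W ≃ₗ[ℂ] (Bond d (towerP L m (n + 1)) → W)).symm.toLinearMap).restrictScalars ℝ) f b =
        WL2.equiv ℂ (fun _ : Bond d (towerP L m (n + 1)) => c₀) W
          (G1k L m n φ η U hL αU hα1 hU1 hreg τ (c₀ := c₀) (c₁ := c₁) hpos f') b := rfl
  rw [hval, UT.toSite_ofSite]
  exact HK n η hηL c₀ c₁ hw hρ m hm U αU hα0 hα1 hU1 hreg εU hεU hUε hLb α hα hαle hUst hUb hUη hpl hUgrad hRlev hεg hAQ hpos' hpos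
    (UT.toSite m v) f' F hfv' hfF' b

end Tower

end Literature.MathematicalPhysics.QuantumFieldTheory.Balaban1983to89.Beta.RemainderHasMajG1kTower

end
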